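import Literature.NumberTheory.ConnesConsani2021.EpsSlopeFrobeniusBridge
import Literature.NumberTheory.ConnesConsani2021.ProlateProjectionsAngleProofs
import HarnessLib

/-!
# Connes–Consani 2021, §4: the sign `(−1)ⁿ` of the prolate eigenvalues `λ(n)` (clause 1 of `CC2021_sec4_lambda_basic`) — PROVED

RH-FREE corpus literature (label, line 1): classical analysis of the prolate spheroidal wave
functions of bandwidth `c = 2π` (Slepian–Pollak 1961); no zeta zeros, no positivity statement, no
claim about RH anywhere in this file.  Cell `rh-crit`, sub-cell `cc/`, seat t10 (g2); bears_on
W-C/W-P only as §4 bookkeeping behind the apex input (A) of the Connes–Consani chain (the named fact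
`CC2021_sec4_lambda_basic` of the statement layer `ProlateProjections.lean`, seat t3, is consumed by
`ArchimedeanTraceFormulaProofs`).  WHAT THIS IS NOT: a statement about RH — nothing here bears on
the truth of RH.  THEOREMS ONLY: no definition, no new named fact.

A. Connes, C. Consani, *Weil positivity and trace formula, the archimedean place*, Selecta Math.
(N.S.) 27 (2021) 77 = arXiv:2006.13771 [bib `ConnesConsani2021`], §4 p. 16 (arXiv p0016:L22–L25):
"The eigenvalues `λ(n)` … are given numerically by the list `λ(0) = 0.999971, λ(1) = −0.979485,
λ(2) = 0.524086, λ(3) = −0.0589766, …`", i.e. `λ(n)` is real with the sign `(−1)ⁿ` — the even-index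
case of "`λ_n = iⁿ|λ_n|`" for the eigenvalues of `F_c φ(x) = ∫_{−1}^{1} e^{icxt}φ(t)dt`
[Rokhlin–Xiao 2007, Thm. 3 p. 109; Slepian–Pollak 1961, §III; Hogan–Lakey 2012, Cor. 1.2.6 and
Lemma 2.6.5].  This is CLAUSE 1 `∀ n, 0 < (−1)ⁿ·λ(n)` of the named fact `CC2021_sec4_lambda_basic`
(clauses 2 and 4 are the tree theorems `abs_prolateEigen_lt_one`, `tendsto_prolateEigen_zero`; clause 3
is proved in the sequel file `ProlateEigenvalueOrdering.lean`).

## The proof given here (fixed bandwidth; no continuation in `c`)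

The printed proofs obtain the sign by continuity in the bandwidth from the Legendre limit `c → 0`
([Hogan–Lakey 2012, Lemma 2.6.5]).  We give instead an argument at the fixed value `c = 2π`, read
off the principal Frobenius solution `u = u_b = frobSol 1 b` of the tree (normalised `u(1) = 1`,
critical parameter `b`: `u′(0) = 0`, `k` zeros in `(0,1)`), for which the tree already knows
`λ(k) = 2∫₀¹u / u(0)` (`prolateEigen_eq_of_frobSol`) and `sign u(0) = (−1)ᵏ` (`pow_mul_pos_of_zeros`),
so that clause 1 is the statement **`∫₀¹ u_b > 0`**.  Put `𝓘(y) := ∫₀¹ u(x) cosh(2πxy) dx`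
(the prolate function continued to the imaginary axis, up to the factor `λ(k)/2`).  Then
* ("lucky accident" on the imaginary axis) `W_x cosh(2πxy) = M_y cosh(2πxy)` with
  `W = −∂ₓ(1−x²)∂ₓ + (2πx)²`, `M_y = (1+y²)∂_y² + 2y∂_y − (2πy)²`, and two integrations by parts whose
  boundary terms vanish (`u′(0) = 0`, the weight `1 − x²` at `x = 1`, `∂ₓcosh(2πxy) = 0` at `x = 0`)
  give `((1+y²)𝓘′)′ = (b + 4π²y²)·𝓘` (`cosh_transform_ode`);
* `b > 0` (`frobSol₁_zero_neg_of_nonpos`), `𝓘′(0) = 0`, so the sign of `𝓘` cannot change on `[0,∞)`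
  (`pos_of_ode`: `(1+y²)𝓘′` is monotone while `𝓘 > 0`);
* `u(1) = 1 > 0` makes `𝓘(y) > 0` for large `y` (the end point `x = 1` dominates,
  `exists_cosh_transform_pos`);
* `𝓘(0) = ∫₀¹u ≠ 0` because `λ(k) ≠ 0` (`prolateEigen_ne_zero`); hence `∫₀¹u > 0`.

References for the statements: [cite: ConnesConsani2021, §4 p. 16 (arXiv p0016:L22–L25)];
[cite: SlepianPollak1961, §III]; [cite: RokhlinXiao2007, Thm. 3 p. 109];
[cite: HoganLakey2012, Lemma 2.6.5 and Lemma 2.6.8].  The fixed-`c` route is this file's own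
(elementary; tagged [folklore] on the auxiliary lemmas).
-/

noncomputable section

open Real Set Filter Topology MeasureTheory intervalIntegral

namespace Literature.NumberTheory.ConnesConsani2021

open Literature.NumberTheory.LFunctions

/-! ## Generic real analysis: a positivity-propagation lemma -/

/-- **Positivity propagation** for `(1+y²)g″ + 2y g′ = q·g`, `q > 0`: if `g(0) > 0` and `g′(0) = 0`
then `g > 0` on `[0, ∞)` (while `g > 0`, `(1+y²)g′` increases from `0`, so `g` increases).
[folklore] -/
private theorem pos_of_ode {g g₁ g₂ q : ℝ → ℝ} (hg : ∀ y, HasDerivAt g (g₁ y) y)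
    (hg₁ : ∀ y, HasDerivAt g₁ (g₂ y) y)
    (hode : ∀ y, 0 ≤ y → (1 + y ^ 2) * g₂ y + 2 * y * g₁ y = q y * g y)
    (hq : ∀ y, 0 ≤ y → 0 < q y) (h0 : 0 < g 0) (h1 : g₁ 0 = 0) :
    ∀ y, 0 ≤ y → 0 < g y := by
  by_contra hcon
  push Not at hcon
  obtain ⟨y₁, hy₁, hgy₁⟩ := hcon
  have hgc : Continuous g := continuous_iff_continuousAt.2 fun y ↦ (hg y).continuousAt
  set S : Set ℝ := Ici 0 ∩ g ⁻¹' Iic 0 with hS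
  have hScl : IsClosed S := isClosed_Ici.inter (isClosed_Iic.preimage hgc)
  have hSne : S.Nonempty := ⟨y₁, hy₁, hgy₁⟩
  have hSbdd : BddBelow S := ⟨0, fun y hy ↦ hy.1⟩
  set t₀ := sInf S with ht₀
  have ht₀S : t₀ ∈ S := hScl.csInf_mem hSne hSbdd
  have ht₀0 : 0 ≤ t₀ := ht₀S.1
  have hgt₀ : g t₀ ≤ 0 := ht₀S.2
  have ht₀pos : 0 < t₀ := lt_of_le_of_ne ht₀0 fun h ↦ by
    rw [← h] at hgt₀; linarith
  have hpos : ∀ y ∈ Ico 0 t₀, 0 < g y := by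
    intro y hy
    by_contra h
    push Not at h
    exact absurd (csInf_le hSbdd ⟨hy.1, h⟩) (not_le.2 hy.2)
  -- `P = (1+y²) g₁` is non-decreasing on `[0, t₀]`
  set P : ℝ → ℝ := fun y ↦ (1 + y ^ 2) * g₁ y with hP
  have hPd : ∀ y, HasDerivAt P ((1 + y ^ 2) * g₂ y + 2 * y * g₁ y) y := by
    intro y
    have h1 : HasDerivAt (fun y : ℝ ↦ 1 + y ^ 2) (2 * y) y := by
      simpa using (hasDerivAt_pow 2 y).const_add 1
    exact (h1.mul (hg₁ y)).congr_deriv (by ring)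
  have hPmono : MonotoneOn P (Icc 0 t₀) := by
    apply monotoneOn_of_deriv_nonneg (convex_Icc 0 t₀)
    · exact fun y _ ↦ (hPd y).continuousAt.continuousWithinAt
    · intro y _; exact (hPd y).differentiableAt.differentiableWithinAt
    · rw [interior_Icc]
      intro y hy
      rw [(hPd y).deriv, hode y hy.1.le]
      exact mul_nonneg (hq y hy.1.le).le (hpos y ⟨hy.1.le, hy.2⟩).le
  have hg₁nn : ∀ y ∈ Icc 0 t₀, 0 ≤ g₁ y := by
    intro y hy
    have h := hPmono (left_mem_Icc.2 ht₀0) hy hy.1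
    simp only [hP, h1] at h
    have h1y : 0 < 1 + y ^ 2 := by positivity
    have : 0 ≤ (1 + y ^ 2) * g₁ y := by simpa using h
    exact (mul_nonneg_iff_of_pos_left h1y).mp this
  have hgmono : MonotoneOn g (Icc 0 t₀) := by
    apply monotoneOn_of_deriv_nonneg (convex_Icc 0 t₀) (hgc.continuousOn)
    · intro y _; exact (hg y).differentiableAt.differentiableWithinAt
    · rw [interior_Icc]
      intro y hy
      rw [(hg y).deriv]
      exact hg₁nn y (Ioo_subset_Icc_self hy)
  have := hgmono (left_mem_Icc.2 ht₀0) (right_mem_Icc.2 ht₀0) ht₀0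
  linarith

/-! ## Generic real analysis: differentiating `∫₀¹ g(x)·cosh(axy) dx` in `y`, and its sign for large `y` -/

/-- `d/dy ∫₀¹ g(x) cosh(axy) dx = ∫₀¹ g(x)·ax·sinh(axy) dx` for `g` continuous on `[0,1]`
(differentiation under the integral sign, dominated on a compact `y`-interval). [folklore] -/
private theorem hasDerivAt_integral_mul_cosh {g : ℝ → ℝ} (hg : ContinuousOn g (Icc 0 1)) (a y₀ : ℝ) :
    HasDerivAt (fun y ↦ ∫ x in (0:ℝ)..1, g x * Real.cosh (a * x * y))
      (∫ x in (0:ℝ)..1, g x * (Real.sinh (a * x * y₀) * (a * x))) y₀ := by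
  obtain ⟨M, hM⟩ := isCompact_Icc.exists_bound_of_continuousOn hg
  have hI : Set.uIoc (0:ℝ) 1 = Ioc 0 1 := uIoc_of_le zero_le_one
  have hcF : ∀ y, ContinuousOn (fun x ↦ g x * Real.cosh (a * x * y)) (Icc 0 1) := fun y ↦
    hg.mul (Continuous.continuousOn (by fun_prop))
  have hcF' : ∀ y, ContinuousOn (fun x ↦ g x * (Real.sinh (a * x * y) * (a * x))) (Icc 0 1) :=
    fun y ↦ hg.mul (Continuous.continuousOn (by fun_prop))
  refine (intervalIntegral.hasDerivAt_integral_of_dominated_loc_of_deriv_le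
    (F := fun y x ↦ g x * Real.cosh (a * x * y))
    (F' := fun y x ↦ g x * (Real.sinh (a * x * y) * (a * x)))
    (s := Icc (y₀ - 1) (y₀ + 1)) (bound := fun _ ↦ M * (Real.cosh (|a| * (|y₀| + 1)) * |a|))
    (Icc_mem_nhds (by linarith) (by linarith)) ?_ ?_ ?_ ?_ intervalIntegrable_const ?_).2
  · exact Eventually.of_forall fun y ↦
      ((hcF y).mono (by rw [hI]; exact Ioc_subset_Icc_self)).aestronglyMeasurable
        measurableSet_uIoc
  · exact (hcF y₀).intervalIntegrable_of_Icc zero_le_one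
  · exact ((hcF' y₀).mono (by rw [hI]; exact Ioc_subset_Icc_self)).aestronglyMeasurable
      measurableSet_uIoc
  · refine Eventually.of_forall fun x hx y hy ↦ ?_
    rw [hI] at hx
    have hx1 : |x| ≤ 1 := by rw [abs_of_pos hx.1]; exact hx.2
    have hy1 : |y| ≤ |y₀| + 1 := by
      rcases le_or_gt 0 y with h | h
      · rw [abs_of_nonneg h]; linarith [hy.2, le_abs_self y₀]
      · rw [abs_of_neg h]; linarith [hy.1, neg_abs_le y₀]
    have hsinh : |Real.sinh (a * x * y)| ≤ Real.cosh (|a| * (|y₀| + 1)) := by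
      have h1 : |Real.sinh (a * x * y)| ≤ Real.cosh (a * x * y) := by
        rw [abs_le]
        constructor
        · have := Real.sinh_lt_cosh (-(a * x * y))
          rw [Real.sinh_neg, Real.cosh_neg] at this
          linarith
        · exact (Real.sinh_lt_cosh _).le
      refine h1.trans (Real.cosh_le_cosh.2 ?_)
      rw [abs_of_nonneg (by positivity : (0:ℝ) ≤ |a| * (|y₀| + 1)), abs_mul, abs_mul]
      calc |a| * |x| * |y| ≤ |a| * 1 * (|y₀| + 1) := by
            gcongr
        _ = |a| * (|y₀| + 1) := by ring
    rw [Real.norm_eq_abs, abs_mul, abs_mul, abs_mul]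
    have hgx : |g x| ≤ M := by simpa [Real.norm_eq_abs] using hM x (Ioc_subset_Icc_self hx)
    calc |g x| * (|Real.sinh (a * x * y)| * (|a| * |x|))
        ≤ M * (Real.cosh (|a| * (|y₀| + 1)) * (|a| * 1)) := by
          gcongr
          exact (abs_nonneg _).trans hgx
      _ = M * (Real.cosh (|a| * (|y₀| + 1)) * |a|) := by ring
  · refine Eventually.of_forall fun x _ y _ ↦ ?_
    have h1 : HasDerivAt (fun y : ℝ ↦ a * x * y) (a * x) y := by
      simpa using (hasDerivAt_id y).const_mul (a * x)
    exact h1.cosh.const_mul (g x)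

/-- `d/dy ∫₀¹ g(x)·sinh(axy)·(ax) dx = ∫₀¹ g(x)·cosh(axy)·(ax)² dx` for `g` continuous on `[0,1]`.
[folklore] -/
private theorem hasDerivAt_integral_mul_sinh {g : ℝ → ℝ} (hg : ContinuousOn g (Icc 0 1)) (a y₀ : ℝ) :
    HasDerivAt (fun y ↦ ∫ x in (0:ℝ)..1, g x * (Real.sinh (a * x * y) * (a * x)))
      (∫ x in (0:ℝ)..1, g x * (Real.cosh (a * x * y₀) * (a * x) * (a * x))) y₀ := by
  obtain ⟨M, hM⟩ := isCompact_Icc.exists_bound_of_continuousOn hg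
  have hI : Set.uIoc (0:ℝ) 1 = Ioc 0 1 := uIoc_of_le zero_le_one
  have hcF : ∀ y, ContinuousOn (fun x ↦ g x * (Real.sinh (a * x * y) * (a * x))) (Icc 0 1) :=
    fun y ↦ hg.mul (Continuous.continuousOn (by fun_prop))
  have hcF' : ∀ y, ContinuousOn (fun x ↦ g x * (Real.cosh (a * x * y) * (a * x) * (a * x)))
      (Icc 0 1) := fun y ↦ hg.mul (Continuous.continuousOn (by fun_prop))
  refine (intervalIntegral.hasDerivAt_integral_of_dominated_loc_of_deriv_le
    (F := fun y x ↦ g x * (Real.sinh (a * x * y) * (a * x)))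
    (F' := fun y x ↦ g x * (Real.cosh (a * x * y) * (a * x) * (a * x)))
    (s := Icc (y₀ - 1) (y₀ + 1)) (bound := fun _ ↦ M * (Real.cosh (|a| * (|y₀| + 1)) * |a| * |a|))
    (Icc_mem_nhds (by linarith) (by linarith)) ?_ ?_ ?_ ?_ intervalIntegrable_const ?_).2
  · exact Eventually.of_forall fun y ↦
      ((hcF y).mono (by rw [hI]; exact Ioc_subset_Icc_self)).aestronglyMeasurable
        measurableSet_uIoc
  · exact (hcF y₀).intervalIntegrable_of_Icc zero_le_one
  · exact ((hcF' y₀).mono (by rw [hI]; exact Ioc_subset_Icc_self)).aestronglyMeasurable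
      measurableSet_uIoc
  · refine Eventually.of_forall fun x hx y hy ↦ ?_
    rw [hI] at hx
    have hx1 : |x| ≤ 1 := by rw [abs_of_pos hx.1]; exact hx.2
    have hy1 : |y| ≤ |y₀| + 1 := by
      rcases le_or_gt 0 y with h | h
      · rw [abs_of_nonneg h]; linarith [hy.2, le_abs_self y₀]
      · rw [abs_of_neg h]; linarith [hy.1, neg_abs_le y₀]
    have hcosh : |Real.cosh (a * x * y)| ≤ Real.cosh (|a| * (|y₀| + 1)) := by
      rw [abs_of_pos (Real.cosh_pos _)]
      refine Real.cosh_le_cosh.2 ?_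
      rw [abs_of_nonneg (by positivity : (0:ℝ) ≤ |a| * (|y₀| + 1)), abs_mul, abs_mul]
      calc |a| * |x| * |y| ≤ |a| * 1 * (|y₀| + 1) := by
            gcongr
        _ = |a| * (|y₀| + 1) := by ring
    rw [Real.norm_eq_abs, abs_mul, abs_mul, abs_mul, abs_mul]
    have hgx : |g x| ≤ M := by simpa [Real.norm_eq_abs] using hM x (Ioc_subset_Icc_self hx)
    calc |g x| * (|Real.cosh (a * x * y)| * (|a| * |x|) * (|a| * |x|))
        ≤ M * (Real.cosh (|a| * (|y₀| + 1)) * (|a| * 1) * (|a| * 1)) := by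
          gcongr
          exact (abs_nonneg _).trans hgx
      _ = M * (Real.cosh (|a| * (|y₀| + 1)) * |a| * |a|) := by ring
  · refine Eventually.of_forall fun x _ y _ ↦ ?_
    have h1 : HasDerivAt (fun y : ℝ ↦ a * x * y) (a * x) y := by
      simpa using (hasDerivAt_id y).const_mul (a * x)
    exact (h1.sinh.mul_const (a * x)).const_mul (g x)

/-- **End-point dominance.**  If `g` is continuous on `[0,1]` with `g(1) > 0` and `a > 0`, then
`∫₀¹ g(x) cosh(axy) dx > 0` for some `y ≥ 0` (indeed for all large `y`: the contribution of a
neighbourhood of `x = 1` grows like `cosh(ay)` and dominates). [folklore] -/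
private theorem exists_integral_mul_cosh_pos {g : ℝ → ℝ} (hg : ContinuousOn g (Icc 0 1)) (hg1 : 0 < g 1)
    {a : ℝ} (ha : 0 < a) : ∃ y : ℝ, 0 ≤ y ∧ 0 < ∫ x in (0:ℝ)..1, g x * Real.cosh (a * x * y) := by
  obtain ⟨M, hM⟩ := isCompact_Icc.exists_bound_of_continuousOn hg
  have hM0 : 0 ≤ M := (norm_nonneg _).trans (hM 1 (right_mem_Icc.2 zero_le_one))
  -- `g ≥ g(1)/2` on `[1 − δ, 1]`
  obtain ⟨δ, hδ0, hδ1, hδ⟩ : ∃ δ : ℝ, 0 < δ ∧ δ ≤ 1 ∧ ∀ x ∈ Icc (1 - δ) 1, g 1 / 2 ≤ g x := by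
    have hc := Metric.continuousWithinAt_iff.mp (hg 1 (right_mem_Icc.2 zero_le_one)) (g 1 / 2)
      (by linarith)
    obtain ⟨δ₀, hδ₀, h⟩ := hc
    refine ⟨min (δ₀ / 2) 1, by positivity, min_le_right _ _, fun x hx ↦ ?_⟩
    have hx0 : 0 ≤ x := by linarith [hx.1, min_le_right (δ₀ / 2) (1:ℝ)]
    have hd : dist x 1 < δ₀ := by
      rw [Real.dist_eq, abs_lt]
      constructor <;> linarith [hx.1, hx.2, min_le_left (δ₀ / 2) (1:ℝ)]
    have := h ⟨hx0, hx.2⟩ hd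
    rw [Real.dist_eq, abs_lt] at this
    linarith [this.1]
  -- choose `y` with `e^{aδy/2} ≥ 16 M/(g 1 · δ) + 1`
  set A : ℝ := 16 * M / (g 1 * δ) with hA
  have hA0 : 0 ≤ A := by rw [hA]; positivity
  set y : ℝ := 2 * A / (a * δ) with hy
  have hy0 : 0 ≤ y := by rw [hy]; positivity
  refine ⟨y, hy0, ?_⟩
  have hkey : A + 1 ≤ Real.exp (a * δ * y / 2) := by
    have : a * δ * y / 2 = A := by rw [hy]; field_simp
    rw [this]; exact Real.add_one_le_exp A
  -- split the integral at `1 − δ` and at `1 − δ/2`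
  have hcF : ContinuousOn (fun x ↦ g x * Real.cosh (a * x * y)) (Icc 0 1) :=
    hg.mul (Continuous.continuousOn (by fun_prop))
  have hii : ∀ s t, 0 ≤ s → t ≤ 1 → s ≤ t →
      IntervalIntegrable (fun x ↦ g x * Real.cosh (a * x * y)) volume s t := fun s t hs ht hst ↦
    (hcF.mono (Icc_subset_Icc hs ht)).intervalIntegrable_of_Icc hst
  have h1 : ∫ x in (0:ℝ)..1, g x * Real.cosh (a * x * y)
      = (∫ x in (0:ℝ)..(1 - δ), g x * Real.cosh (a * x * y))
        + ((∫ x in (1 - δ)..(1 - δ / 2), g x * Real.cosh (a * x * y))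
        + ∫ x in (1 - δ / 2)..1, g x * Real.cosh (a * x * y)) := by
    rw [intervalIntegral.integral_add_adjacent_intervals (hii _ _ (by linarith) (by linarith)
        (by linarith)) (hii _ _ (by linarith) le_rfl (by linarith)),
      intervalIntegral.integral_add_adjacent_intervals (hii _ _ le_rfl (by linarith) (by linarith))
        (hii _ _ (by linarith) le_rfl (by linarith))]
  -- the piece on `[0, 1−δ]` is `≥ −M cosh(a(1−δ)y)`
  have hcosh_mono : ∀ s t, 0 ≤ s → s ≤ t → Real.cosh (a * s * y) ≤ Real.cosh (a * t * y) := by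
    intro s t hs hst
    have ht : 0 ≤ t := hs.trans hst
    refine Real.cosh_le_cosh.2 ?_
    rw [abs_of_nonneg (by positivity), abs_of_nonneg (by positivity)]
    gcongr
  have hp1 : -(M * Real.cosh (a * (1 - δ) * y)) ≤ ∫ x in (0:ℝ)..(1 - δ), g x * Real.cosh (a * x * y) := by
    have hb : ‖∫ x in (0:ℝ)..(1 - δ), g x * Real.cosh (a * x * y)‖
        ≤ M * Real.cosh (a * (1 - δ) * y) * |1 - δ - 0| := by
      refine intervalIntegral.norm_integral_le_of_norm_le_const fun x hx ↦ ?_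
      rw [uIoc_of_le (by linarith)] at hx
      rw [norm_mul, Real.norm_eq_abs, Real.norm_eq_abs, abs_of_pos (Real.cosh_pos _)]
      have hgx : |g x| ≤ M := by
        simpa [Real.norm_eq_abs] using hM x ⟨hx.1.le, by linarith [hx.2]⟩
      exact mul_le_mul hgx (hcosh_mono x (1 - δ) hx.1.le hx.2) (Real.cosh_pos _).le hM0
    rw [Real.norm_eq_abs] at hb
    have h3 : M * Real.cosh (a * (1 - δ) * y) * |1 - δ - 0| ≤ M * Real.cosh (a * (1 - δ) * y) := by
      have : |1 - δ - 0| ≤ 1 := by rw [abs_le]; constructor <;> linarith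
      have h4 : 0 ≤ M * Real.cosh (a * (1 - δ) * y) := by positivity
      nlinarith
    linarith [neg_abs_le (∫ x in (0:ℝ)..(1 - δ), g x * Real.cosh (a * x * y))]
  -- the piece on `[1−δ, 1−δ/2]` is `≥ 0`
  have hp2 : 0 ≤ ∫ x in (1 - δ)..(1 - δ / 2), g x * Real.cosh (a * x * y) := by
    refine intervalIntegral.integral_nonneg (by linarith) fun x hx ↦ ?_
    have := hδ x ⟨hx.1, by linarith [hx.2]⟩
    exact mul_nonneg (by linarith) (Real.cosh_pos _).le
  -- the piece on `[1−δ/2, 1]` is `≥ (g 1/2)(δ/2) cosh(a(1−δ/2)y)`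
  have hp3 : g 1 / 2 * Real.cosh (a * (1 - δ / 2) * y) * (δ / 2)
      ≤ ∫ x in (1 - δ / 2)..1, g x * Real.cosh (a * x * y) := by
    have hc : ∫ _ in (1 - δ / 2)..(1:ℝ), g 1 / 2 * Real.cosh (a * (1 - δ / 2) * y)
        = g 1 / 2 * Real.cosh (a * (1 - δ / 2) * y) * (δ / 2) := by
      rw [intervalIntegral.integral_const, smul_eq_mul]; ring
    rw [← hc]
    refine intervalIntegral.integral_mono_on (by linarith) intervalIntegrable_const
      (hii _ _ (by linarith) le_rfl (by linarith)) fun x hx ↦ ?_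
    have hgx := hδ x ⟨by linarith [hx.1], hx.2⟩
    exact mul_le_mul hgx (hcosh_mono _ _ (by linarith) hx.1) (Real.cosh_pos _).le
      (by linarith)
  -- compare: `(g 1/2)(δ/2) cosh(a(1−δ/2)y) > M cosh(a(1−δ)y)`
  have hdom : M * Real.cosh (a * (1 - δ) * y)
      < g 1 / 2 * Real.cosh (a * (1 - δ / 2) * y) * (δ / 2) := by
    have hlow : Real.exp (a * (1 - δ / 2) * y) / 2 ≤ Real.cosh (a * (1 - δ / 2) * y) := by
      rw [Real.cosh_eq]; linarith [Real.exp_pos (-(a * (1 - δ / 2) * y))]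
    have hup : Real.cosh (a * (1 - δ) * y) ≤ Real.exp (a * (1 - δ) * y) := by
      rw [Real.cosh_eq]
      have : Real.exp (-(a * (1 - δ) * y)) ≤ Real.exp (a * (1 - δ) * y) :=
        Real.exp_le_exp.2 (by nlinarith [mul_nonneg (mul_nonneg ha.le (by linarith : (0:ℝ) ≤ 1 - δ)) hy0])
      linarith
    have hsplit : Real.exp (a * (1 - δ / 2) * y)
        = Real.exp (a * (1 - δ) * y) * Real.exp (a * δ * y / 2) := by
      rw [← Real.exp_add]; ring_nf
    have hE0 : 0 < Real.exp (a * (1 - δ) * y) := Real.exp_pos _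
    have hg1δ : 0 < g 1 * δ := mul_pos hg1 hδ0
    -- `M e ≤ (g1 δ/16)(A+1) e - ...`: from `A = 16M/(g1 δ)`
    have hMA : M = g 1 * δ / 16 * A := by rw [hA]; field_simp
    calc M * Real.cosh (a * (1 - δ) * y)
        ≤ M * Real.exp (a * (1 - δ) * y) := by gcongr
      _ < g 1 * δ / 16 * (A + 1) * Real.exp (a * (1 - δ) * y) := by
          rw [hMA]
          have : g 1 * δ / 16 * A * Real.exp (a * (1 - δ) * y)
              < g 1 * δ / 16 * A * Real.exp (a * (1 - δ) * y)
                + g 1 * δ / 16 * Real.exp (a * (1 - δ) * y) := by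
            linarith [mul_pos (by positivity : (0:ℝ) < g 1 * δ / 16) hE0]
          linarith
      _ ≤ g 1 * δ / 16 * (Real.exp (a * δ * y / 2) * Real.exp (a * (1 - δ) * y)) := by
          rw [mul_assoc]
          gcongr
      _ = g 1 / 2 * (Real.exp (a * (1 - δ / 2) * y) / 2) * (δ / 2) * (1 / 2) := by
          rw [hsplit]; ring
      _ ≤ g 1 / 2 * Real.cosh (a * (1 - δ / 2) * y) * (δ / 2) * (1 / 2) := by gcongr
      _ ≤ g 1 / 2 * Real.cosh (a * (1 - δ / 2) * y) * (δ / 2) := by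
          have : 0 ≤ g 1 / 2 * Real.cosh (a * (1 - δ / 2) * y) * (δ / 2) := by
            have := Real.cosh_pos (a * (1 - δ / 2) * y); positivity
          linarith
  rw [h1]
  linarith

/-! ## The cosh transform of the principal Frobenius solution and its differential equation -/

section Frob

variable {b : ℝ}

/-- On `[0,1]` the principal Frobenius solution `u_b = frobSol 1 b` is within the disc of convergence
`|1 − x| < 2`. [folklore] -/
private theorem abs_one_sub_lt_two_of_mem_Icc {x : ℝ} (hx : x ∈ Icc (0:ℝ) 1) : |1 - x| < 2 * 1 :=
  abs_sub_lt_two_mul_of_mem_Icc one_pos hx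

/-- `u_b` is continuous on `[0,1]`. [folklore] -/
private theorem continuousOn_frobSol_Icc_one (b : ℝ) : ContinuousOn (frobSol 1 b) (Icc 0 1) :=
  continuousOn_frobSol_Icc one_pos b

/-- **The cosh transform solves the "imaginary-axis" prolate equation.**  For a critical parameter
`b` (`u_b′(0) = 0`) and every real `y`,
`(1+y²)·∫₀¹u_b(x)cosh(2πxy)(2πx)²dx + 2y·∫₀¹u_b(x)sinh(2πxy)(2πx)dx = (b + 4π²y²)·∫₀¹u_b(x)cosh(2πxy)dx`,
i.e. `𝓘(y) = ∫₀¹u_b(x)cosh(2πxy)dx` satisfies `((1+y²)𝓘′)′ = (b + 4π²y²)𝓘`.  Mechanism: the pointwise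
"lucky accident" `W_x cosh(2πxy) = M_y cosh(2πxy)` (`W = −∂ₓ(1−x²)∂ₓ + (2πx)²`,
`M_y = (1+y²)∂_y² + 2y∂_y − 4π²y²`) and `∫₀¹ u·W k = ∫₀¹ (W u)·k = b∫₀¹ u k`, the boundary terms of the two
integrations by parts vanishing because of the weight `1 − x²` at `x = 1` and of `u′(0) = 0`,
`∂ₓcosh(2πxy)|_{x=0} = 0` at `x = 0`.
[cite: SlepianPollak1961, §III ("lucky accident": `W` commutes with the finite Fourier transform)]
[folklore] -/
theorem cosh_transform_ode (hB : frobSol₁ 1 b 0 = 0) (y : ℝ) :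
    (1 + y ^ 2) * (∫ x in (0:ℝ)..1,
        frobSol 1 b x * (Real.cosh (2 * π * x * y) * (2 * π * x) * (2 * π * x)))
      + 2 * y * (∫ x in (0:ℝ)..1, frobSol 1 b x * (Real.sinh (2 * π * x * y) * (2 * π * x)))
      = (b + (2 * π) ^ 2 * y ^ 2) * ∫ x in (0:ℝ)..1, frobSol 1 b x * Real.cosh (2 * π * x * y) := by
  set u := frobSol 1 b with hu
  set u₁ := frobSol₁ 1 b with hu₁
  set u₂ := frobSol₂ 1 b with hu₂
  have hmem : ∀ x ∈ Icc (0:ℝ) 1, |1 - x| < 2 * 1 := fun x hx ↦ abs_one_sub_lt_two_of_mem_Icc hx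
  have hud : ∀ x ∈ Icc (0:ℝ) 1, HasDerivAt u (u₁ x) x := fun x hx ↦
    hasDerivAt_frobSol one_pos b (hmem x hx)
  have hu₁d : ∀ x ∈ Icc (0:ℝ) 1, HasDerivAt u₁ (u₂ x) x := fun x hx ↦
    hasDerivAt_frobSol₁ one_pos b (hmem x hx)
  have hode : ∀ x ∈ Icc (0:ℝ) 1,
      (1 ^ 2 - x ^ 2) * u₂ x - 2 * x * u₁ x + (b - (2 * π * 1 * x) ^ 2) * u x = 0 := fun x hx ↦
    frobSol_ode one_pos b (hmem x hx)
  have huc : ContinuousOn u (Icc 0 1) := fun x hx ↦ (hud x hx).continuousAt.continuousWithinAt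
  have hu₁c : ContinuousOn u₁ (Icc 0 1) := fun x hx ↦ (hu₁d x hx).continuousAt.continuousWithinAt
  have hu₂c : ContinuousOn u₂ (Icc 0 1) := fun x hx ↦
    (differentiableAt_frobSol₂ one_pos b (hmem x hx)).continuousAt.continuousWithinAt
  -- the kernel and its `x`-derivatives
  set k : ℝ → ℝ := fun x ↦ Real.cosh (2 * π * x * y) with hk
  set k₁ : ℝ → ℝ := fun x ↦ Real.sinh (2 * π * x * y) * (2 * π * y) with hk₁
  set k₂ : ℝ → ℝ := fun x ↦ Real.cosh (2 * π * x * y) * (2 * π * y) * (2 * π * y) with hk₂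
  have hlin : ∀ x, HasDerivAt (fun x : ℝ ↦ 2 * π * x * y) (2 * π * y) x := fun x ↦ by
    simpa using ((hasDerivAt_id x).const_mul (2 * π)).mul_const y
  have hkd : ∀ x, HasDerivAt k (k₁ x) x := fun x ↦ (hlin x).cosh
  have hk₁d : ∀ x, HasDerivAt k₁ (k₂ x) x := fun x ↦ (hlin x).sinh.mul_const _
  -- `Φ = (1 − x²)(u₁ k − u k₁)`
  set Φ : ℝ → ℝ := fun x ↦ (1 - x ^ 2) * (u₁ x * k x - u x * k₁ x) with hΦ
  set Φ' : ℝ → ℝ := fun x ↦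
    (1 + y ^ 2) * (u x * (Real.cosh (2 * π * x * y) * (2 * π * x) * (2 * π * x)))
      + 2 * y * (u x * (Real.sinh (2 * π * x * y) * (2 * π * x)))
      - (2 * π) ^ 2 * y ^ 2 * (u x * Real.cosh (2 * π * x * y))
      - b * (u x * Real.cosh (2 * π * x * y)) with hΦ'
  have hΦd : ∀ x ∈ uIcc (0:ℝ) 1, HasDerivAt Φ (Φ' x) x := by
    intro x hx
    rw [uIcc_of_le zero_le_one] at hx
    have hp : HasDerivAt (fun x : ℝ ↦ 1 - x ^ 2) (-(2 * x)) x := by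
      simpa using (hasDerivAt_pow 2 x).const_sub 1
    have hin : HasDerivAt (fun x ↦ u₁ x * k x - u x * k₁ x)
        (u₂ x * k x + u₁ x * k₁ x - (u₁ x * k₁ x + u x * k₂ x)) x :=
      ((hu₁d x hx).mul (hkd x)).sub ((hud x hx).mul (hk₁d x))
    refine (hp.mul hin).congr_deriv ?_
    simp only [hΦ', hk, hk₁, hk₂]
    linear_combination (Real.cosh (2 * π * x * y)) * hode x hx
  have hΦ'c : ContinuousOn Φ' (Icc 0 1) := by
    simp only [hΦ']
    have h1 : ContinuousOn (fun x ↦ u x * (Real.cosh (2 * π * x * y) * (2 * π * x) * (2 * π * x)))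
        (Icc 0 1) := huc.mul (Continuous.continuousOn (by fun_prop))
    have h2 : ContinuousOn (fun x ↦ u x * (Real.sinh (2 * π * x * y) * (2 * π * x))) (Icc 0 1) :=
      huc.mul (Continuous.continuousOn (by fun_prop))
    have h3 : ContinuousOn (fun x ↦ u x * Real.cosh (2 * π * x * y)) (Icc 0 1) :=
      huc.mul (Continuous.continuousOn (by fun_prop))
    exact (((continuousOn_const.mul h1).add (continuousOn_const.mul h2)).sub
      (continuousOn_const.mul h3)).sub (continuousOn_const.mul h3)
  have hint : IntervalIntegrable Φ' volume 0 1 := hΦ'c.intervalIntegrable_of_Icc zero_le_one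
  have hFTC := intervalIntegral.integral_eq_sub_of_hasDerivAt hΦd hint
  have hΦ1 : Φ 1 = 0 := by simp [hΦ]
  have hΦ0 : Φ 0 = 0 := by
    simp only [hΦ, hk, hk₁]
    rw [hB]; simp
  rw [hΦ1, hΦ0, sub_zero] at hFTC
  -- split the integral of `Φ'`
  have hi1 : IntervalIntegrable
      (fun x ↦ u x * (Real.cosh (2 * π * x * y) * (2 * π * x) * (2 * π * x))) volume 0 1 :=
    (huc.mul (Continuous.continuousOn (by fun_prop))).intervalIntegrable_of_Icc zero_le_one
  have hi2 : IntervalIntegrable (fun x ↦ u x * (Real.sinh (2 * π * x * y) * (2 * π * x)))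
      volume 0 1 :=
    (huc.mul (Continuous.continuousOn (by fun_prop))).intervalIntegrable_of_Icc zero_le_one
  have hi3 : IntervalIntegrable (fun x ↦ u x * Real.cosh (2 * π * x * y)) volume 0 1 :=
    (huc.mul (Continuous.continuousOn (by fun_prop))).intervalIntegrable_of_Icc zero_le_one
  have hsplit : ∫ x in (0:ℝ)..1, Φ' x
      = (1 + y ^ 2) * (∫ x in (0:ℝ)..1,
          u x * (Real.cosh (2 * π * x * y) * (2 * π * x) * (2 * π * x)))
        + 2 * y * (∫ x in (0:ℝ)..1, u x * (Real.sinh (2 * π * x * y) * (2 * π * x)))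
        - (2 * π) ^ 2 * y ^ 2 * (∫ x in (0:ℝ)..1, u x * Real.cosh (2 * π * x * y))
        - b * ∫ x in (0:ℝ)..1, u x * Real.cosh (2 * π * x * y) := by
    simp only [hΦ']
    rw [intervalIntegral.integral_sub ((((hi1.const_mul _).add (hi2.const_mul _)).sub
        (hi3.const_mul _))) (hi3.const_mul _),
      intervalIntegral.integral_sub ((hi1.const_mul _).add (hi2.const_mul _)) (hi3.const_mul _),
      intervalIntegral.integral_add (hi1.const_mul _) (hi2.const_mul _),
      intervalIntegral.integral_const_mul, intervalIntegral.integral_const_mul,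
      intervalIntegral.integral_const_mul, intervalIntegral.integral_const_mul]
  rw [hsplit] at hFTC
  linarith

/-- **`∫₀¹ u_b > 0`** for a critical parameter `b` with `k` zeros of `u_b` in `(0,1)`: the core of
clause 1.  (`b > 0` by `frobSol₁_zero_neg_of_nonpos`; `∫₀¹u_b ≠ 0` because `λ(k) = 2∫₀¹u_b/u_b(0) ≠ 0`;
then `cosh_transform_ode`, `pos_of_ode` applied to `−𝓘` and `exists_integral_mul_cosh_pos`.)  In the
Frobenius normalisation `u_b(1) = 1` this IS the printed sign statement "`λ_{2k} = i^{2k}|λ_{2k}|`", since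
`λ(k) = 2∫₀¹u_b/u_b(0)` and `sign u_b(0) = (−1)ᵏ`.
[cite: RokhlinXiao2007, Thm. 3 p. 109] [cite: HoganLakey2012, Lemma 2.6.5]
[cite: ConnesConsani2021, §4 p. 16 (arXiv p0016:L22–L25)] -/
theorem integral_frobSol_pos {k : ℕ} (hB : frobSol₁ 1 b 0 = 0)
    (hN : {x | x ∈ Ioo (0:ℝ) 1 ∧ frobSol 1 b x = 0}.ncard = k) :
    0 < ∫ x in (0:ℝ)..1, frobSol 1 b x := by
  have hb : 0 < b := by
    by_contra h
    push Not at h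
    have := frobSol₁_zero_neg_of_nonpos one_pos h (lam := 1)
    rw [hB] at this
    exact lt_irrefl _ this
  have huc := continuousOn_frobSol_Icc_one b
  have hne : (∫ x in (0:ℝ)..1, frobSol 1 b x) ≠ 0 := by
    intro h0
    have hlam := prolateEigen_eq_of_frobSol hB hN
    rw [h0, mul_zero, zero_div] at hlam
    exact prolateEigen_ne_zero k hlam
  by_contra hcon
  have hneg : (∫ x in (0:ℝ)..1, frobSol 1 b x) < 0 := lt_of_le_of_ne (not_lt.1 hcon) hne
  -- `g = −𝓘`
  set K : ℝ → ℝ := fun y ↦ ∫ x in (0:ℝ)..1, frobSol 1 b x * Real.cosh (2 * π * x * y) with hK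
  set K₁ : ℝ → ℝ := fun y ↦
    ∫ x in (0:ℝ)..1, frobSol 1 b x * (Real.sinh (2 * π * x * y) * (2 * π * x)) with hK₁
  set K₂ : ℝ → ℝ := fun y ↦ ∫ x in (0:ℝ)..1,
    frobSol 1 b x * (Real.cosh (2 * π * x * y) * (2 * π * x) * (2 * π * x)) with hK₂
  have hKd : ∀ y, HasDerivAt K (K₁ y) y := fun y ↦ hasDerivAt_integral_mul_cosh huc (2 * π) y
  have hK₁d : ∀ y, HasDerivAt K₁ (K₂ y) y := fun y ↦ hasDerivAt_integral_mul_sinh huc (2 * π) y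
  have hpos := pos_of_ode (g := fun y ↦ -K y) (g₁ := fun y ↦ -K₁ y) (g₂ := fun y ↦ -K₂ y)
    (q := fun y ↦ b + (2 * π) ^ 2 * y ^ 2) (fun y ↦ (hKd y).neg) (fun y ↦ (hK₁d y).neg)
    (fun y _ ↦ by have := cosh_transform_ode hB y; simp only [hK, hK₁, hK₂]; linarith)
    (fun y _ ↦ by positivity) (by simpa [hK] using hneg) (by simp [hK₁])
  obtain ⟨y, hy0, hy⟩ := exists_integral_mul_cosh_pos huc (by rw [frobSol_self]; exact one_pos)
    Real.two_pi_pos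
  have := hpos y hy0
  simp only [hK] at this
  linarith

end Frob

/-! ## Clause 1 of `CC2021_sec4_lambda_basic` -/

/-- **Clause 1 of `CC2021_sec4_lambda_basic`: `(−1)ⁿλ(n) > 0` for every `n`** — the eigenvalue of the
finite cosine transform on the `n`-th even prolate function of bandwidth `2π` is real with the sign
`(−1)ⁿ` (the even-index case of "`λ_n = iⁿ|λ_n|`").  Proof: `λ(n) = 2∫₀¹u_b/u_b(0)` at a critical
Frobenius parameter with `n` zeros (`prolateEigen_eq_of_frobSol`), `∫₀¹u_b > 0` (`integral_frobSol_pos`)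
and `sign u_b(0) = (−1)ⁿ` (`pow_mul_pos_of_zeros`, `u_b(1) = 1`, simple zeros).
[cite: ConnesConsani2021, §4 p. 16 (arXiv p0016:L22–L25)] [cite: RokhlinXiao2007, Thm. 3 p. 109]
[cite: SlepianPollak1961, §III] [cite: HoganLakey2012, Lemma 2.6.5] -/
theorem neg_one_pow_mul_prolateEigen_pos (n : ℕ) : 0 < (-1 : ℝ) ^ n * prolateEigen n := by
  obtain ⟨b, hB, hN⟩ := exists_frobSol₁_zero_eq one_pos n
  rw [frobZeros_def] at hN
  have hI := integral_frobSol_pos hB hN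
  have hlam := prolateEigen_eq_of_frobSol hB hN
  have h0 : frobSol 1 b 0 ≠ 0 := fun h ↦
    frobSol₁_ne_zero_of_zero one_pos b ⟨by norm_num, by norm_num⟩ h hB
  have hder : ∀ z ∈ Ioo (0:ℝ) 1, frobSol 1 b z = 0 → ∃ d ≠ 0, HasDerivAt (frobSol 1 b) d z :=
    fun z hz hz0 ↦ ⟨frobSol₁ 1 b z, frobSol₁_ne_zero_of_zero one_pos b ⟨by linarith [hz.1], hz.2⟩ hz0,
      hasDerivAt_frobSol one_pos b (by rw [abs_lt]; constructor <;> linarith [hz.1, hz.2])⟩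
  have hu0 : 0 < (-1 : ℝ) ^ n * frobSol 1 b 0 :=
    pow_mul_pos_of_zeros zero_lt_one (continuousOn_frobSol_Icc_one b) (finite_zeros_frobSol one_pos b)
      hN hder (by rw [frobSol_self]; exact one_pos) h0
  rw [hlam]
  have h1 : (-1 : ℝ) ^ n * (2 * (∫ x in (0:ℝ)..1, frobSol 1 b x) / frobSol 1 b 0)
      = 2 * (∫ x in (0:ℝ)..1, frobSol 1 b x) * ((-1 : ℝ) ^ n * frobSol 1 b 0)
          / (frobSol 1 b 0 * frobSol 1 b 0) := by
    field_simp
  rw [h1]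
  exact div_pos (mul_pos (mul_pos two_pos hI) hu0) (mul_self_pos.2 h0)

/-- Clause 1 in the exact form of the named fact `CC2021_sec4_lambda_basic`.
[cite: ConnesConsani2021, §4 p. 16 (arXiv p0016:L22–L25)] -/
theorem CC2021_sec4_lambda_basic_clause_1 : ∀ n : ℕ, 0 < (-1 : ℝ) ^ n * prolateEigen n :=
  neg_one_pow_mul_prolateEigen_pos

/-- Consecutive eigenvalues have opposite signs: `λ(n)·λ(n+1) < 0`.
[cite: ConnesConsani2021, §4 p. 16 (arXiv p0016:L22–L25)] -/
theorem prolateEigen_mul_succ_neg (n : ℕ) : prolateEigen n * prolateEigen (n + 1) < 0 := by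
  have h1 := neg_one_pow_mul_prolateEigen_pos n
  have h2 := neg_one_pow_mul_prolateEigen_pos (n + 1)
  have h3 : 0 < ((-1 : ℝ) ^ n * prolateEigen n) * ((-1 : ℝ) ^ (n + 1) * prolateEigen (n + 1)) :=
    mul_pos h1 h2
  have h4 : ((-1 : ℝ) ^ n * prolateEigen n) * ((-1 : ℝ) ^ (n + 1) * prolateEigen (n + 1))
      = -(prolateEigen n * prolateEigen (n + 1)) := by
    rw [pow_succ]
    have : ((-1 : ℝ) ^ n) * ((-1 : ℝ) ^ n) = 1 := by
      rw [← mul_pow]; norm_num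
    linear_combination (-(prolateEigen n * prolateEigen (n + 1))) * this
  linarith

/-- The sign of `λ(n)` written out: `λ(n) > 0` for even `n`, `λ(n) < 0` for odd `n`.
[cite: ConnesConsani2021, §4 p. 16 (arXiv p0016:L22–L25)] -/
theorem prolateEigen_pos_iff_even (n : ℕ) : (0 < prolateEigen n ↔ Even n) ∧ (prolateEigen n < 0 ↔ Odd n) := by
  have h := neg_one_pow_mul_prolateEigen_pos n
  rcases Nat.even_or_odd n with he | ho
  · rw [he.neg_one_pow, one_mul] at h
    exact ⟨⟨fun _ ↦ he, fun _ ↦ h⟩, ⟨fun h' ↦ absurd h (not_lt.2 h'.le), fun ho ↦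
      absurd he (Nat.not_even_iff_odd.2 ho)⟩⟩
  · rw [ho.neg_one_pow, neg_one_mul, neg_pos] at h
    exact ⟨⟨fun h' ↦ absurd h (not_lt.2 h'.le), fun he ↦ absurd he (Nat.not_even_iff_odd.2 ho)⟩,
      ⟨fun _ ↦ ho, fun _ ↦ h⟩⟩

end Literature.NumberTheory.ConnesConsani2021
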